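import Summits.CriticalPhenomena.PercolationContinuityZ3.Theorems.PercNearOneGluingNoHeavyPcintBSMCompute
import HarnessLib

/-!
# PCINT lane, PHASE 5 (block-renewal second moment), step 10: the kernel theorem

Cell `prim-pcint`, seat `prim-pcint-1` (gen 14); memo `run/shared/lean/prim/pcint/T-FIBRE-ROUTE.md` §PHASE 5.

Part 2 of the kernel layer: the boxes `[-D, D]^t` as explicit LISTS (`BSM.boxList`, `BSM.mem_boxList`,
`BSM.Box_eq_toFinset`) so that every finite quantifier and sum the kernel evaluates runs over a list, the rational
marginal identity (`BSM.MargQ`), the INTEGER certificate functional with natural-number tables `V̂₀, V̂₁` and all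
denominators cleared (`BSM.certLHSz`, `BSM.certLHSz_cast`), and **`BSM.criticalProb_le_of_checks`**: decidable
hypotheses in natural/integer arithmetic (cube conditions, the marginal identity, fixed-point Green-table domination on
the sorted offsets of `[-6,6]^t`, potential-table domination on `[-4,4]^t`, the certificate inequalities on `[-2,2]^t`),
plus a tail bound `BSM.TailBound` (discharged from `ℚ` checks in `…PcintBSMTails`), imply `p_c^bond(ℤ^{k+t}) ≤ P/10^4`.  `BSM.forall_take_drop` splits a list quantifier into chunks (small kernel jobs).
-/

noncomputable section

namespace Summit.CriticalPhenomena.PercolationContinuityZ3.Theorems.Pcint.BSM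

open Finset OSM Literature.Probability.Percolation Literature.Probability.LatticeModels

variable {t k np : ℕ}

/-! ### Boxes as lists -/

/-- The box `[-D, D]^t` as a list of functions (built with `Fin.cons`). -/
def boxList : (t D : ℕ) → List (Fin t → ℤ)
  | 0, _ => [fun i => i.elim0]
  | t + 1, D => (List.range (2 * D + 1)).flatMap fun j : ℕ => (boxList t D).map fun δ => Fin.cons ((j : ℤ) - D) δ

/-- Membership in the list box, coordinatewise. -/
theorem mem_boxList : ∀ {t : ℕ} (D : ℕ) (δ : Fin t → ℤ), δ ∈ boxList t D ↔ ∀ i, -(D : ℤ) ≤ δ i ∧ δ i ≤ D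
  | 0, D, δ => by
    simp only [boxList, List.mem_singleton, IsEmpty.forall_iff, iff_true]
    funext i; exact i.elim0
  | t + 1, D, δ => by
    simp only [boxList, List.mem_flatMap, List.mem_map]
    constructor
    · rintro ⟨j, hj, δ', hδ', rfl⟩ i
      have hj' : j < 2 * D + 1 := List.mem_range.1 hj
      refine Fin.cases ?_ (fun i => ?_) i
      · simp only [Fin.cons_zero]; omega
      · simpa only [Fin.cons_succ] using (mem_boxList D δ').1 hδ' i
    · intro h
      refine ⟨(δ 0 + D).toNat, List.mem_range.2 (by have := h 0; omega), Fin.tail δ,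
        (mem_boxList D _).2 fun i => h i.succ, ?_⟩
      have h0 := h 0
      rw [show ((δ 0 + D).toNat : ℤ) - D = δ 0 by omega]
      exact Fin.cons_self_tail δ

/-- The list box has no duplicates. -/
theorem nodup_boxList : ∀ (t D : ℕ), (boxList t D).Nodup
  | 0, _ => List.nodup_singleton _
  | t + 1, D => by
    rw [boxList, List.nodup_flatMap]
    refine ⟨fun j _ => (nodup_boxList t D).map (Fin.cons_right_injective (α := fun _ => ℤ) _), ?_⟩
    refine List.Nodup.pairwise_of_forall_ne List.nodup_range fun j _ j' _ hjj' => ?_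
    simp only [Function.onFun, List.disjoint_left, List.mem_map]
    rintro _ ⟨δ, _, rfl⟩ ⟨δ', _, h⟩
    have := congr_fun h 0
    simp only [Fin.cons_zero] at this
    omega

/-- `Box t D` is the list box. -/
theorem Box_eq_toFinset (t D : ℕ) : Box t D = (boxList t D).toFinset := by
  ext δ; rw [mem_Box, List.mem_toFinset, mem_boxList]

/-- Sums over `Box t D` are list sums. -/
theorem sum_Box_eq (t D : ℕ) (f : (Fin t → ℤ) → ℝ) : ∑ z ∈ Box t D, f z = ((boxList t D).map f).sum := by
  rw [Box_eq_toFinset, List.sum_toFinset _ (nodup_boxList t D)]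

/-- The sorted offsets of `[-D, D]^t`: the fixed points of `canonK` in the list box. -/
def canonList (t D : ℕ) : List (Fin t → ℤ) := (boxList t D).filter fun δ => canonK δ = δ

/-- Every offset of the box canonicalises into `canonList`. -/
theorem canonK_mem_canonList (t D : ℕ) : ∀ δ ∈ boxList t D, canonK δ ∈ canonList t D := by
  intro δ hδ
  rw [canonList, List.mem_filter, decide_eq_true_eq]
  refine ⟨?_, canonK_canonK δ⟩
  rw [← List.mem_toFinset, ← Box_eq_toFinset]
  exact canonK_mem_Box (by rw [Box_eq_toFinset, List.mem_toFinset]; exact hδ)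

/-- Splitting a list quantifier (one kernel file per chunk). -/
theorem forall_take_drop {α : Type*} {l : List α} {P : α → Prop} (n : ℕ) (h1 : ∀ y ∈ l.take n, P y)
    (h2 : ∀ y ∈ l.drop n, P y) : ∀ y ∈ l, P y := by
  intro y hy
  rw [← List.take_append_drop n l, List.mem_append] at hy
  exact hy.elim (h1 y) (h2 y)

/-- `code (val c) = c`. -/
theorem code_val (c : Fin 3) : code (val c) = c := by
  fin_cases c <;> rfl

/-- Every letter vector is coded by a point of `[-1,1]^t`. -/
theorem exists_boxList_code (v : Fin t → Fin 3) : ∃ δ ∈ boxList t 1, v = fun i => code (δ i) := by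
  refine ⟨fun i => val (v i), (mem_boxList 1 _).2 fun i => ?_, funext fun i => (code_val (v i)).symm⟩
  unfold val; have := (v i).2; constructor <;> push_cast <;> omega

/-! ### The rational certificate functional -/

/-- The three-point law over `ℚ`. -/
def g₃q (s : ℚ) (c : Fin 3) : ℚ := if c = 1 then 1 - s / 2 else s / 4

/-- `g₃q` casts to `g₃`. -/
theorem g₃q_cast (s : ℚ) (c : Fin 3) : ((g₃q s c : ℚ) : ℝ) = g₃ (s : ℝ) c := by
  unfold g₃q g₃; split_ifs <;> push_cast <;> ring

/-- **The rational marginal hypothesis**, quantified over the list box `[-1,1]^t` of coded letter vectors. -/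
def MargQ (pc : Fin np → List (Fin t × Bool)) (wq : Fin np → ℚ) (s : ℚ) : Prop :=
  ∀ δ ∈ boxList t 1, ∑ σ : Fin np, (if codev pc σ = (fun i => code (δ i)) then wq σ else 0) = ∏ i, g₃q s (code (δ i))

/-- The rational marginal hypothesis gives the real one. -/
theorem marg_of_margQ {pc : Fin np → List (Fin t × Bool)} {wq : Fin np → ℚ} {s : ℚ} (h : MargQ pc wq s) :
    Marg pc (fun σ => (wq σ : ℝ)) (s : ℝ) := by
  intro v
  obtain ⟨δ, hδ, rfl⟩ := exists_boxList_code v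
  have := congr_arg (fun q : ℚ => (q : ℝ)) (h δ hδ)
  push_cast at this
  simp only [g₃q_cast] at this
  convert this using 2 with σ
  split_ifs <;> simp

/-- The tail constant over `ℚ`. -/
def CtailQ (k : ℕ) (s : ℚ) : ℚ := (k : ℚ) ^ 2 / (16 * ((k : ℚ) - 1) * s) + 1 / (8 * s ^ 2)

/-- `CtailQ` casts to `Ctail`. -/
theorem CtailQ_cast (k : ℕ) (s : ℚ) : ((CtailQ k s : ℚ) : ℝ) = Ctail k (s : ℝ) := by
  unfold CtailQ Ctail; push_cast; ring

/-! ### The integer certificate functional -/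

/-- A piece has at most `|σ|` transverse keys. -/
theorem card_tedges_le (k : ℕ) : ∀ (u : Fin t → ℤ) (σ : List (Fin t × Bool)), (tedges k u σ).card ≤ σ.length
  | u, [] => by simp [tedges]
  | u, q :: σ => by
    rw [tedges, List.length_cons]
    exact (Finset.card_insert_le _ _).trans (by have := card_tedges_le k (u + sv q) σ; omega)

/-- `S ≤ |σ'|`. -/
theorem S_le_length (pc : Fin np → List (Fin t × Bool)) (k : ℕ) (y : Fin t → ℤ) (σ σ' : Fin np) :
    S pc k y σ σ' ≤ (pc σ').length := by
  unfold S
  exact (Finset.card_le_card Finset.inter_subset_right).trans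
    (by rw [Finset.card_map]; exact card_tedges_le k 0 _)

/-- `(A/B)^n - 1 = (A^n B^(E-n) - B^E) / B^E` for `n ≤ E`. -/
theorem pow_pad {A B E n : ℕ} (hn : n ≤ E) (hB : 0 < B) :
    ((A : ℝ) / B) ^ n - 1 = ((((A ^ n * B ^ (E - n) : ℕ) : ℤ) - ((B ^ E : ℕ) : ℤ) : ℤ) : ℝ) / (B : ℝ) ^ E := by
  have hBR : (0 : ℝ) < B := by exact_mod_cast hB
  have hsplit : (B : ℝ) ^ E = (B : ℝ) ^ n * (B : ℝ) ^ (E - n) := by rw [← pow_add, Nat.add_sub_cancel' hn]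
  push_cast
  rw [div_pow, eq_div_iff (by positivity), hsplit]
  field_simp

/-- **The integer certificate functional**: integer weights `W`, ratio `x = A/B` with exponents padded to `E`,
natural tables `V0n, V1n`, endpoint table `pe`, shared-key count `St` (all denominators cleared). -/
def certLHSz (pe : Fin np → (Fin t → ℤ)) (St : (Fin t → ℤ) → Fin np → Fin np → ℕ) (W : Fin np → ℕ) (k A B E : ℕ)
    (V0n V1n : (Fin t → ℤ) → ℕ) (y : Fin t → ℤ) : ℤ :=
  ∑ σ : Fin np, ∑ σ' : Fin np,
    let s := St y σ σ'
    let n := s + (if pe σ = pe σ' + y then 1 else 0)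
    let uo := y + (pe σ' - pe σ)
    ((W σ * W σ' : ℕ) : ℤ) *
      ((((A ^ n * B ^ (E - n) : ℕ) : ℤ) - ((B ^ E : ℕ) : ℤ)) * ((V0n uo : ℕ) : ℤ) +
        ((k - 1 : ℕ) : ℤ) * ((((A ^ s * B ^ (E - s) : ℕ) : ℤ) - ((B ^ E : ℕ) : ℤ)) * ((V1n uo : ℕ) : ℤ)))

/-- **`certLHSz` is `certLHS` with denominators cleared** (factor `k · B^E · DW² · DV`). -/
theorem certLHSz_cast (pc : Fin np → List (Fin t × Bool)) {pe : Fin np → (Fin t → ℤ)} (hpe : ∀ σ, pe σ = pend (pc σ))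
    (W : Fin np → ℕ) {k : ℕ} (hk : 1 ≤ k) (A : ℕ) {B E : ℕ} (hB : 0 < B) (hE : ∀ σ, (pc σ).length + 1 ≤ E)
    (V0n V1n : (Fin t → ℤ) → ℕ) (y : Fin t → ℤ) {DW DV : ℕ} (hDW : 0 < DW) (hDV : 0 < DV) :
    ((certLHSz pe (S pc k) W k A B E V0n V1n y : ℤ) : ℝ) =
      certLHS pc (fun σ => (W σ : ℝ) / DW) k ((A : ℝ) / B) (fun u => (V0n u : ℝ) / DV) (fun u => (V1n u : ℝ) / DV) y *
        ((k : ℝ) * (B : ℝ) ^ E * (DW : ℝ) ^ 2 * DV) := by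
  have hBR : (0 : ℝ) < B := by exact_mod_cast hB
  unfold certLHSz certLHS
  simp only [hpe]
  rw [Finset.sum_mul]
  push_cast
  refine sum_congr rfl fun σ _ => ?_
  rw [Finset.sum_mul]
  refine sum_congr rfl fun σ' _ => ?_
  have h1 : S pc k y σ σ' ≤ E := (S_le_length pc k y σ σ').trans (by have := hE σ'; omega)
  have h0 : S pc k y σ σ' + (if pend (pc σ) = pend (pc σ') + y then 1 else 0) ≤ E := by
    have := S_le_length pc k y σ σ'; have := hE σ'; split_ifs <;> omega
  have e0 := pow_pad (A := A) h0 hB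
  have e1 := pow_pad (A := A) h1 hB
  push_cast at e0 e1
  rw [e0, e1]
  have hk' : ((k - 1 : ℕ) : ℝ) = (k : ℝ) - 1 := by rw [Nat.cast_sub hk]; simp
  rw [hk']
  field_simp

/-- Sums of naturals over the list box, cast to `ℝ`. -/
theorem cast_boxSum (G Φn : (Fin t → ℤ) → ℕ) (Tn : ℕ) (u : Fin t → ℤ) :
    (((1 + ((boxList t 2).map fun z => (G (canonK (z - u)) + Tn) * Φn z).sum : ℕ) : ℝ)) =
      1 + ∑ z ∈ Ybox t, (((G (canonK (z - u)) : ℝ) + Tn) * Φn z) := by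
  rw [Nat.cast_add, Nat.cast_one, Nat.cast_list_sum, List.map_map, sum_Box_eq]
  congr 1
  exact congr_arg _ (List.map_congr_left fun z _ => by simp only [Function.comp_apply]; push_cast; ring)

/-! ### The kernel theorem -/

/-- **`p_c^bond(ℤ^{k+t}) ≤ P/10^4` from decidable checks** (integer certificate). -/
theorem criticalProb_le_of_checks (hk : 2 ≤ k) (pc : Fin np → List (Fin t × Bool))
    (pe : Fin np → (Fin t → ℤ)) (hpe : ∀ σ, pe σ = pend (pc σ)) (E : ℕ) (hE : ∀ σ, (pc σ).length + 1 ≤ E)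
    (St : (Fin t → ℤ) → Fin np → Fin np → ℕ) (hSt : ∀ y ∈ boxList t 2, ∀ σ σ', St y σ σ' = S pc k y σ σ')
    (W : Fin np → ℕ) (DW : ℕ) (hDW : 0 < DW)
    {a b : ℕ} (ha : 0 < a) (hab : a ≤ b) (hcube : Cube pc) (hkc : KeyCube pc k)
    (hmarg : MargQ pc (fun σ => (W σ : ℚ) / DW) ((a : ℚ) / b)) {P : ℕ} (hP0 : 0 < P) (hP1 : P ≤ 10000)
    {N : ℕ} (D DU DG DΦ Tn : ℕ) (hD : 0 < D) (hDU : 0 < DU) (hDG : 0 < DG) (hDΦ : 0 < DΦ)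
    (hT : TailBound t k ((a : ℝ) / b) N ((Tn : ℝ) / DG)) (U C : List ℕ)
    (hU : ∀ i ∈ List.range N, uqv (OSM.vrow k N) k i * DU ≤ (U.getD i 0 : ℚ))
    (hC : ∀ i ∈ List.range N, cadjqv (OSM.vrow k (N + 1)) k i * DU ≤ (C.getD i 0 : ℚ))
    (G0n G1n V0n V1n Φn : (Fin t → ℤ) → ℕ) (CL : List (Fin t → ℤ)) (hCL : ∀ δ ∈ boxList t 6, canonK δ ∈ CL)
    (hG0 : ∀ δ ∈ CL, GqN (termsU a b D N 6 U) 6 δ * DG ≤ G0n δ * (DU * D ^ t))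
    (hG1 : ∀ δ ∈ CL, GqN (termsU a b D N 6 C) 6 δ * DG ≤ G1n δ * (DU * D ^ t))
    (hV0 : ∀ u ∈ boxList t 4, 1 + ((boxList t 2).map fun z => (G0n (canonK (z - u)) + Tn) * Φn z).sum ≤ V0n u)
    (hV1 : ∀ u ∈ boxList t 4, 1 + ((boxList t 2).map fun z => (G1n (canonK (z - u)) + Tn) * Φn z).sum ≤ V1n u)
    (hcert : ∀ y ∈ boxList t 2, certLHSz pe St W k 10000 P E V0n V1n y * DΦ ≤
      (Φn y : ℤ) * ((P ^ E * k * DW ^ 2 * (DG * DΦ) : ℕ) : ℤ)) :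
    criticalProb (zdGraph (k + t)) (0 : Site (k + t)) ≤ (P : ℝ) / 10000 := by
  have hb : 0 < b := lt_of_lt_of_le ha hab
  have hbR : (0 : ℝ) < b := by exact_mod_cast hb
  have hPR : (0 : ℝ) < P := by exact_mod_cast hP0
  have hDGR : (0 : ℝ) < DG := by exact_mod_cast hDG
  have hDΦR : (0 : ℝ) < DΦ := by exact_mod_cast hDΦ
  have hDWR : (0 : ℝ) < DW := by exact_mod_cast hDW
  set s : ℝ := (((a : ℚ) / b : ℚ) : ℝ) with hs
  have hsab : s = (a : ℝ) / b := by rw [hs]; push_cast; rfl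
  have hs0 : 0 < s := by rw [hsab]; positivity
  have hs1 : s ≤ 1 := by rw [hsab, div_le_one hbR]; exact_mod_cast hab
  have hp0 : (0 : ℝ) < (P : ℝ) / 10000 := by positivity
  have hp1 : (P : ℝ) / 10000 ≤ 1 := by rw [div_le_one (by norm_num)]; exact_mod_cast hP1
  -- the weights
  set w : Fin np → ℝ := fun σ => (W σ : ℝ) / DW with hw
  have hmarg' : Marg pc w s := by
    have h := marg_of_margQ hmarg
    have : (fun σ => ((((W σ : ℚ) / DW : ℚ)) : ℝ)) = w := by funext σ; rw [hw]; push_cast; rfl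
    rwa [this] at h
  have hw0 : ∀ σ, 0 ≤ w σ := fun σ => by rw [hw]; positivity
  -- boxes: `z ∈ [-2,2]^t`, `u ∈ [-4,4]^t` ⇒ `z - u ∈ [-6,6]^t`
  have hzu : ∀ z ∈ boxList t 2, ∀ u ∈ boxList t 4, z - u ∈ boxList t 6 := by
    intro z hz u hu
    rw [mem_boxList] at hz hu ⊢
    intro i
    have h1 := hz i; have h2 := hu i
    simp only [Pi.sub_apply]
    push_cast at h1 h2 ⊢
    constructor <;> omega
  have hYb : ∀ z, z ∈ Ybox t → z ∈ boxList t 2 := fun z hz => by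
    rwa [show Ybox t = (boxList t 2).toFinset from Box_eq_toFinset t 2, List.mem_toFinset] at hz
  have hcanB : ∀ z ∈ boxList t 2, ∀ u ∈ boxList t 4, canonK (z - u) ∈ Box t 6 := fun z hz u hu =>
    canonK_mem_Box (by rw [Box_eq_toFinset, List.mem_toFinset]; exact hzu z hz u hu)
  -- the potential, extended by zero outside `[-2,2]^t`, and the tables over `ℝ`
  set φ : (Fin t → ℤ) → ℝ := fun y => if y ∈ boxList t 2 then (Φn y : ℝ) / DΦ else 0 with hφdef
  have hφ0 : ∀ y, 0 ≤ φ y := fun y => by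
    rw [hφdef]; dsimp only; split_ifs
    · positivity
    · exact le_rfl
  have hφin : ∀ y ∈ boxList t 2, φ y = (Φn y : ℝ) / DΦ := fun y hy => by rw [hφdef]; dsimp only; rw [if_pos hy]
  set V0f : (Fin t → ℤ) → ℝ := fun u => (V0n u : ℝ) / ((DG * DΦ : ℕ) : ℝ) with hV0f
  set V1f : (Fin t → ℤ) → ℝ := fun u => (V1n u : ℝ) / ((DG * DΦ : ℕ) : ℝ) with hV1f
  -- the coefficient lists dominate `u k i · DU` and `cadj k i · DU`
  have hU' : ∀ i < N, u k i * DU ≤ (U.getD i 0 : ℝ) := fun i hi => by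
    have h := (Rat.cast_le (K := ℝ)).2 (hU i (List.mem_range.2 hi))
    push_cast at h
    rwa [uqv_cast hi.le] at h
  have hC' : ∀ i < N, cadj k i * DU ≤ (C.getD i 0 : ℝ) := fun i hi => by
    have h := (Rat.cast_le (K := ℝ)).2 (hC i (List.mem_range.2 hi))
    push_cast at h
    rwa [cadjqv_cast (by omega)] at h
  have hM : (0 : ℝ) < (DU : ℝ) * (D : ℝ) ^ t := by positivity
  -- Green tables over `ℝ`
  have hG0' : ∀ z ∈ boxList t 2, ∀ u ∈ boxList t 4,
      G0N k s N (z - u) + (Tn : ℝ) / DG ≤ (((G0n (canonK (z - u)) : ℝ) + Tn) / DG) := by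
    intro z hz u hu
    rw [add_div]
    refine add_le_add ?_ le_rfl
    rw [← G0N_canonK, le_div_iff₀ hDGR]
    have h1 := G0N_le_GqN (k := k) hab hb D DU N hU' (hcanB z hz u hu)
    have h2 : ((GqN (termsU a b D N 6 U) 6 (canonK (z - u)) : ℕ) : ℝ) * DG ≤
        (G0n (canonK (z - u)) : ℝ) * ((DU : ℝ) * (D : ℝ) ^ t) := by
      exact_mod_cast hG0 _ (hCL _ (hzu z hz u hu))
    rw [hsab]
    nlinarith [h1, h2, hM, hDGR]
  have hG1' : ∀ z ∈ boxList t 2, ∀ u ∈ boxList t 4,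
      G1N k s N (z - u) + (Tn : ℝ) / DG ≤ (((G1n (canonK (z - u)) : ℝ) + Tn) / DG) := by
    intro z hz u hu
    rw [add_div]
    refine add_le_add ?_ le_rfl
    rw [← G1N_canonK, le_div_iff₀ hDGR]
    have h1 := G1N_le_GqN (k := k) hab hb D DU N hC' (hcanB z hz u hu)
    have h2 : ((GqN (termsU a b D N 6 C) 6 (canonK (z - u)) : ℕ) : ℝ) * DG ≤
        (G1n (canonK (z - u)) : ℝ) * ((DU : ℝ) * (D : ℝ) ^ t) := by
      exact_mod_cast hG1 _ (hCL _ (hzu z hz u hu))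
    rw [hsab]
    nlinarith [h1, h2, hM, hDGR]
  -- the potential tables over `ℝ`
  have hVgen : ∀ (Gr : (Fin t → ℤ) → ℝ) (Gn Vn : (Fin t → ℤ) → ℕ),
      (∀ z ∈ boxList t 2, ∀ u ∈ boxList t 4, Gr (z - u) + (Tn : ℝ) / DG ≤ (((Gn (canonK (z - u)) : ℝ) + Tn) / DG)) →
      (∀ u ∈ boxList t 4, 1 + ((boxList t 2).map fun z => (Gn (canonK (z - u)) + Tn) * Φn z).sum ≤ Vn u) →
      ∀ u ∈ Box t 4, (1 / ((DG * DΦ : ℕ) : ℝ) + ∑ z ∈ Ybox t, (Gr (z - u) + (Tn : ℝ) / DG) * φ z) ≤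
        (Vn u : ℝ) / ((DG * DΦ : ℕ) : ℝ) := by
    intro Gr Gn Vn hGr hVn u hu
    rw [Box_eq_toFinset, List.mem_toFinset] at hu
    have hsum : ∑ z ∈ Ybox t, (Gr (z - u) + (Tn : ℝ) / DG) * φ z ≤
        ∑ z ∈ Ybox t, ((((Gn (canonK (z - u)) : ℝ) + Tn) / DG) * ((Φn z : ℝ) / DΦ)) :=
      sum_le_sum fun z hz => by
        rw [hφin z (hYb z hz)]
        exact mul_le_mul_of_nonneg_right (hGr z (hYb z hz) u hu) (by positivity)
    have hcast : ((Vn u : ℝ)) ≥ ((1 + ((boxList t 2).map fun z => (Gn (canonK (z - u)) + Tn) * Φn z).sum : ℕ) : ℝ) := by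
      exact_mod_cast hVn u hu
    rw [cast_boxSum] at hcast
    have heq : ∑ z ∈ Ybox t, ((((Gn (canonK (z - u)) : ℝ) + Tn) / DG) * ((Φn z : ℝ) / DΦ)) =
        (∑ z ∈ Ybox t, (((Gn (canonK (z - u)) : ℝ) + Tn) * Φn z)) / ((DG * DΦ : ℕ) : ℝ) := by
      rw [Finset.sum_div]
      exact sum_congr rfl fun z _ => by push_cast; ring
    rw [heq] at hsum
    have hpos : (0 : ℝ) < ((DG * DΦ : ℕ) : ℝ) := by positivity
    calc 1 / ((DG * DΦ : ℕ) : ℝ) + ∑ z ∈ Ybox t, (Gr (z - u) + (Tn : ℝ) / DG) * φ z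
        ≤ (1 + ∑ z ∈ Ybox t, (((Gn (canonK (z - u)) : ℝ) + Tn) * Φn z)) / ((DG * DΦ : ℕ) : ℝ) := by
          rw [add_div]; exact add_le_add le_rfl hsum
      _ ≤ (Vn u : ℝ) / ((DG * DΦ : ℕ) : ℝ) := div_le_div_of_nonneg_right hcast hpos.le
  have hV0' : ∀ u ∈ Box t 4, V0 k s N ((Tn : ℝ) / DG) (1 / ((DG * DΦ : ℕ) : ℝ)) φ u ≤ V0f u :=
    hVgen (G0N k s N) G0n V0n hG0' hV0
  have hV1' : ∀ u ∈ Box t 4, V1 k s N ((Tn : ℝ) / DG) (1 / ((DG * DΦ : ℕ) : ℝ)) φ u ≤ V1f u :=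
    hVgen (G1N k s N) G1n V1n hG1' hV1
  have hT' : TailBound t k s N ((Tn : ℝ) / DG) := by rw [hsab]; exact hT
  -- the certificate inequalities over `ℝ`
  have hx : (1 / ((P : ℝ) / 10000)) = ((10000 : ℕ) : ℝ) / P := by push_cast; field_simp
  have hcert' : ∀ y ∈ Ybox t, certLHS pc w k (1 / ((P : ℝ) / 10000)) V0f V1f y ≤ φ y := by
    intro y hy
    replace hy := hYb y hy
    have h := (Int.cast_mono (R := ℝ)) (hcert y hy)
    have hSt' : certLHSz pe St W k 10000 P E V0n V1n y = certLHSz pe (S pc k) W k 10000 P E V0n V1n y := by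
      unfold certLHSz; simp only [hSt y hy]
    rw [hSt'] at h
    push_cast at h
    rw [certLHSz_cast pc hpe W (by omega) 10000 hP0 hE V0n V1n y hDW (by positivity : 0 < DG * DΦ)] at h
    rw [hx, hφin y hy]
    rw [hw, hV0f, hV1f]
    push_cast at h ⊢
    have hMpos : (0 : ℝ) < (k : ℝ) * (P : ℝ) ^ E * (DW : ℝ) ^ 2 * ((DG : ℝ) * DΦ) * DΦ := by positivity
    refine le_of_mul_le_mul_right ?_ hMpos
    calc _ = certLHS pc (fun σ => (W σ : ℝ) / DW) k ((10000 : ℝ) / P) (fun u => (V0n u : ℝ) / ((DG : ℝ) * DΦ))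
          (fun u => (V1n u : ℝ) / ((DG : ℝ) * DΦ)) y * ((k : ℝ) * (P : ℝ) ^ E * (DW : ℝ) ^ 2 * ((DG : ℝ) * DΦ)) * DΦ := by
          ring
      _ ≤ (Φn y : ℝ) * ((P : ℝ) ^ E * k * (DW : ℝ) ^ 2 * ((DG : ℝ) * DΦ)) := h
      _ = _ := by field_simp
  exact criticalProb_le_of_cert hk hcube hkc hmarg' hw0 hp0 hp1 hT' (by positivity) φ hφ0 hV0' hV1' hcert'

end Summit.CriticalPhenomena.PercolationContinuityZ3.Theorems.Pcint.BSM

end
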